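import Summits.BirchSwinnertonDyer.BirchSwinnertonDyer.Theorems.InertBadSignedBranchesCccOneLawOnTypeIstarZeroManinTwist
import Summits.BirchSwinnertonDyer.BirchSwinnertonDyer.Theorems.InertBadSignedBranchesCccOneLawOnTypeIstarZeroStubsOnType
import Summits.BirchSwinnertonDyer.BirchSwinnertonDyer.Theorems.InertBadSignedBranchesCccOneLawOnTypeIstarZeroOfEtaGZ
import Summits.BirchSwinnertonDyer.BirchSwinnertonDyer.Theorems.CMRungInputsLowerHalf
import Summits.BirchSwinnertonDyer.Rank1Residual.X12.ClassClosureO10EtaBranch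
import Summits.BirchSwinnertonDyer.Rank1Residual.X12.CMIrreducible
import Summits.BirchSwinnertonDyer.Rank1Residual.Additive.UnramifiedBaseChange
import HarnessLib

/-!
# Route `InertBadSignedBranches` (rung K8), crux `CccOneLawOnTypeIstarZero` (stmt-…-19223):
# the registered stub U (`stub_etaValuationUpper`) HOLDS at EVERY `p ≥ 5` — the Kolyvagin upper half
# on the signed type `(p, I₀*)` from PUBLISHED facts alone, and the K8 leaf re-read as the lower half
# (helper toward stmt-BirchSwinnertonDyer-19223; cell bsd-cm, seat bsd-cm-k8i-c2 g6; third of three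
# files `…TwistPeriodLattice` → `…ManinTwist` → `…ManinTwistOnType`)

WHAT. The sibling file `…ManinTwist` proves `∃ Dt, p ∤ c(Dt)` for every globally minimal `W` whose
`p*`-twist is good at the odd prime `p` (`W`, twin irreducible at `p`). On the signed type `(p, I₀*)`,
`p ≥ 5` (CM, `p` inert, Kodaira `I₀*`): the good supersingular twin exists
(`X12.O10.exists_goodTwist_pStar_of_hasSignedLocalType_IstarZero`), `W` is additive at `p`
(`EtaGZ.addv_of_hasSignedLocalType_of_twist_good`), `W[p]`, `V[p]` are irreducible (`X12.irr_of_cmInert`):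
* §1 `exists_modularParametrizationData_not_dvd_of_hasSignedLocalType_IstarZero` — the Manin datum on
  the type; **`missingUpperBoundAt_of_hasSignedLocalType_IstarZero`** — `ord_p #Ш(W) ≤ ord_p #Ш(W)_an`
  for EVERY rank-one `W` of the type at EVERY `p ≥ 5` from the PUBLISHED named facts
  `hGZ hKo hMN hGZK hmod hnf hFH hCM8 hMaz` (x1b's `X12.missingUpperBoundAt_of_classX12_of_not_cmRamified'`
  fed with §1; compared with the tree's `X12.missingUpperBoundAt_of_classX12_of_cmInert`, the binders
  `hEdx hDeu hCassels` and the bound `7 < p` are replaced by Mazur 1978 Cor. 4.1);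
  **`stubUpperAt_of_facts`** — the registered stub U at every `p ≥ 5` modulo the route's items
  `PrintReadingsInert` (19226) and `PublishedFactsInert` (19227, whose sixth conjunct IS Mazur's
  fact) — `CccOneStubHalves.stubUpperAt_of_facts_of_seven_lt` without `7 < p`, `hEdx`, `hDeu`, `hCassels`.
* §2 the K8 leaf: `cmInertBad_of_lowerHalf_facts`, **`cmInertBad_iff_lowerHalfOnType_of_facts`** —
  modulo the two residual conjuncts (bodies of `InertBadOffType`, `InertBadAtThree`) and nine PUBLISHED
  facts, `X12.CMInertBad ⟺ ∀ p ≥ 5, LowerHalfOnType p I₀*`: the non-published binder `hup` of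
  `CMRungInputsLowerHalf.cmInertBad_iff_lowerHalfOnType_of_inputs` is discharged.
READING (no label change): on the REGISTERED skeleton of 19223 the only open stub at every `p ≥ 5`
is L = STEP L on the type; the Euler-system half of `BSD(W, p)` on O10-PS is published-unconditional
at EVERY `p ≥ 5` (was: `p ≥ 11`, or `N ≤ 300000` by Cremona's table at `p ∈ {5, 7}`).

HONEST LABEL: theorems only (no `def`, no named fact minted, no `sorry`); every statement is
CONDITIONAL on its displayed hypotheses (route items, published named facts); no registered stub is
closed outright; the crux 19223 (C-cc-1), STEP L, O10 and the leaf stay OPEN; BSD is not proved for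
any curve here; nothing booked.

References: B. Mazur, Invent. Math. 44 (1978) Cor. 4.1; G. Stevens, Invent. Math. 98 (1989) §5;
A. Matar, J. Nekovář, JTNB 31 (2019) Thm. 0.3; A. Burungale, M. Flach, Camb. J. Math. 12 (2024);
S. Kobayashi, Invent. Math. 152 (2003) Thm. 9.3; R. L. Miller, LMS J. Comput. Math. 14 (2011) §1.
-/

set_option autoImplicit false
set_option linter.dupNamespace false

noncomputable section

open scoped Classical MatrixGroups ModularForm NumberField

open CongruenceSubgroup Field WeierstrassCurve NumberField IsDedekindDomain
open Literature.NumberTheory.EllipticCurves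
open Literature.NumberTheory.EllipticCurves.ModularForms
open Literature.NumberTheory.EllipticCurves.Rank1Residual
open Literature.NumberTheory.EllipticCurves.Rank1Residual.Typed
open Literature.NumberTheory.Automorphic
open Summit.BirchSwinnertonDyer.Rank1Residual
open Summit.BirchSwinnertonDyer.Rank1Residual.X12.O10

open Summit.BirchSwinnertonDyer.BirchSwinnertonDyer.Theses.InertBadSignedBranches

namespace Summit.BirchSwinnertonDyer.BirchSwinnertonDyer.Theorems.CccOneManinTwist

/-! ## §1 The signed type `(p, I₀*)`: the Manin datum, the Kolyvagin upper half, the stub U -/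

section SignedType

variable (p : ℕ) [hp : Fact p.Prime]

/-- **The Manin datum on the signed type `(p, I₀*)`, `p ≥ 5`: every globally minimal `W` of signed
local type `(p, I₀*)` (CM, `p` inert, Kodaira `I₀*` at `p`) admits a modular parametrisation datum
at level `N_W` with `p ∤ c`.** The good supersingular twin `V`, `C • W^{(p*)} = V`, exists
(`exists_goodTwist_pStar_of_hasSignedLocalType_IstarZero`); `W` is additive at `p`
(`EtaGZ.addv_of_hasSignedLocalType_of_twist_good`); `W[p]`, `V[p]` are irreducible at the inert odd
`p` (`X12.irr_of_cmInert`); then §2. CONDITIONAL on `hnf` and `hMaz`; nothing booked.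
[cite: Mazur1978, Cor. 4.1] [cite: SilvermanATAEC1994, IV.9.4 Step 6 (PDF p. 345)] -/
theorem exists_modularParametrizationData_not_dvd_of_hasSignedLocalType_IstarZero
    (hnf : exists_isNewformOf) (hMaz : mazur_not_dvd_maninConstant_of_odd)
    (W : WeierstrassCurve ℚ) [W.IsElliptic] [W.IsGloballyMinimal] {N : ℕ} [NeZero N]
    (hN : W.conductorNorm ℤ = N) (hT : HasSignedLocalType W p (.Istar 0)) (hp5 : 5 ≤ p) :
    ∃ Dt : ModularParametrizationData W N, ¬ (p : ℤ) ∣ Dt.c := by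
  have hp2 : p ≠ 2 := by omega
  obtain ⟨V, hVe, hVm, C, hCV, hgood, -, -, hinV, -⟩ :=
    exists_goodTwist_pStar_of_hasSignedLocalType_IstarZero W hT hp5
  haveI := hVe
  haveI := hVm
  have hadd := Additive.hasAdditiveReductionAt_of_addv W p
    (EtaGZ.addv_of_hasSignedLocalType_of_twist_good W hT hp2 C hCV hgood)
  exact exists_modularParametrizationData_not_dvd_of_twist_good hnf hMaz W hN p hp2
    (Additive.primesEquiv_symm_apply_coe p) hadd V C hCV hgood
    (X12.irr_of_cmInert W p hp2 hT.2.1) (X12.irr_of_cmInert V p hp2 hinV)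

/-- **THE KOLYVAGIN (UPPER) HALF OF `BSD(W, p)` ON THE SIGNED TYPE `(p, I₀*)` AT EVERY `p ≥ 5`, EVERY
CURVE, FROM PUBLISHED NAMED FACTS ALONE** — `ord_p #Ш(W) ≤ ord_p #Ш(W)_an` for every globally minimal
`W` of signed type `(p, I₀*)` with `r_an = 1`: x1b's `X12.missingUpperBoundAt_of_classX12_of_not_cmRamified'`
(Gross–Zagier + Kolyvagin over a Friedberg–Hoffstein field in Matar–Nekovář's irreducible form, the
CM rank-zero triple for the twist, `p ∤ ∏ c_ℓ` by Kodaira–Néron) fed with the Manin datum of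
`exists_modularParametrizationData_not_dvd_of_hasSignedLocalType_IstarZero`. Compared with the
tree's every-curve theorem `X12.missingUpperBoundAt_of_classX12_of_cmInert` (`7 < p`, Edixhoven Thm. 3
+ Deuring + Cassels), the binders `hEdx hDeu hCassels` and the bound `7 < p` are replaced by Mazur
1978 Cor. 4.1 (`hMaz`) — so the pairs at `p ∈ {5, 7}` are covered. CONDITIONAL on the displayed
facts; the LOWER half (STEP L) stays open; nothing booked. [cite: Mazur1978, Cor. 4.1]
[cite: MatarNekovar2019, Thm. 0.3 and §0.11] [cite: BurungaleFlach2024, Thm. 1.1 and Cor. 2] -/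
theorem missingUpperBoundAt_of_hasSignedLocalType_IstarZero
    (hGZ : ∀ (N : ℕ) [NeZero N] (W : WeierstrassCurve ℚ) (K : Type) [Field K] [NumberField K],
      gross_zagier N W K)
    (hKo : ∀ (N : ℕ) [NeZero N] (W : WeierstrassCurve ℚ) (K : Type) [Field K] [NumberField K],
      kolyvagin N W K)
    (hMN : ∀ (N : ℕ) [NeZero N] (W : WeierstrassCurve ℚ) (K : Type) [Field K] [NumberField K],
      MatarNekovar2019.thm03_padicValNat_card_sha_le_of_irreducible N W K)
    (hGZK : rank_eq_analyticRank_of_analyticRank_le_one) (hmod : hasEntireLFunction_rat)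
    (hnf : exists_isNewformOf) (hFH : friedbergHoffstein_exists_heegnerField_split_twist_ne_zero)
    (hCM8 : bsdTriple_of_hasCM_of_L_one_ne_zero) (hMaz : mazur_not_dvd_maninConstant_of_odd)
    (W : WeierstrassCurve ℚ) [W.IsElliptic] [W.IsGloballyMinimal] (hp5 : 5 ≤ p)
    (hT : HasSignedLocalType W p (.Istar 0)) (hr : W.analyticRank = 1) : MissingUpperBoundAt W p := by
  haveI : NeZero (W.conductorNorm ℤ) := ⟨(W.conductorNorm_pos_holds).ne'⟩
  obtain ⟨D, hD⟩ :=
    exists_modularParametrizationData_not_dvd_of_hasSignedLocalType_IstarZero p hnf hMaz W rfl hT hp5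
  exact X12.missingUpperBoundAt_of_classX12_of_not_cmRamified' hGZ hKo hMN hGZK hmod hnf hFH hCM8 W p
    (classX12_of_hasSignedLocalType W p hT hr) hp5 hT.2.1.1 D hD

/-- **The binder `hup` of `CMRungInputsLowerHalf.cmInertBad_of_lowerHalf_inputs` DISCHARGED from
published facts**: the upper half on the type at `p ∈ {5, 7}` (indeed at every `p ≥ 5`).
[cite: Mazur1978, Cor. 4.1] [cite: MatarNekovar2019, Thm. 0.3 and §0.11] -/
theorem upperHalfFiveSevenOnType_of_facts
    (hGZ : ∀ (N : ℕ) [NeZero N] (W : WeierstrassCurve ℚ) (K : Type) [Field K] [NumberField K],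
      gross_zagier N W K)
    (hKo : ∀ (N : ℕ) [NeZero N] (W : WeierstrassCurve ℚ) (K : Type) [Field K] [NumberField K],
      kolyvagin N W K)
    (hMN : ∀ (N : ℕ) [NeZero N] (W : WeierstrassCurve ℚ) (K : Type) [Field K] [NumberField K],
      MatarNekovar2019.thm03_padicValNat_card_sha_le_of_irreducible N W K)
    (hGZK : rank_eq_analyticRank_of_analyticRank_le_one) (hmod : hasEntireLFunction_rat)
    (hnf : exists_isNewformOf) (hFH : friedbergHoffstein_exists_heegnerField_split_twist_ne_zero)
    (hCM8 : bsdTriple_of_hasCM_of_L_one_ne_zero) (hMaz : mazur_not_dvd_maninConstant_of_odd) :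
    ∀ (p : ℕ) [Fact p.Prime], p = 5 ∨ p = 7 → ∀ (W : WeierstrassCurve ℚ) [W.IsElliptic]
      [W.IsGloballyMinimal], HasSignedLocalType W p (.Istar 0) → W.analyticRank = 1 →
      MissingUpperBoundAt W p := by
  intro p _ h57 W _ _ hT hr
  exact missingUpperBoundAt_of_hasSignedLocalType_IstarZero p hGZ hKo hMN hGZK hmod hnf hFH hCM8 hMaz W
    (by rcases h57 with rfl | rfl <;> norm_num) hT hr

/-- **The registered stub `stub_etaValuationUpper` of the crux's A12 skeleton HOLDS at EVERY `p ≥ 5`**,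
modulo the route's support items `PrintReadingsInert` (stmt-…-19226) and `PublishedFactsInert`
(stmt-…-19227, which CONTAINS Mazur 1978 Cor. 4.1 as its sixth conjunct) and the eight published facts
of the Kolyvagin half: the `7 < p` of `CccOneStubHalves.stubUpperAt_of_facts_of_seven_lt` and its
binders `hEdx hDeu hCassels` are gone. So on the REGISTERED skeleton the only open stub at every
`p ≥ 5` is L (`X12.O10.LowerHalfOnType p I₀*`, STEP L). CONDITIONAL; the stub itself is
unconditional and is NOT closed outright; nothing booked.
[cite: Mazur1978, Cor. 4.1] [cite: Kobayashi2003, Thm. 9.3 (p. 26)] [cite: Miller2011LMS, §1 and Def. 1.1]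
[cite: MatarNekovar2019, Thm. 0.3 and §0.11] -/
theorem stubUpperAt_of_facts (h₅ : PrintReadingsInert) (h₆ : PublishedFactsInert)
    (hGZ : ∀ (N : ℕ) [NeZero N] (W : WeierstrassCurve ℚ) (K : Type) [Field K] [NumberField K],
      gross_zagier N W K)
    (hKo : ∀ (N : ℕ) [NeZero N] (W : WeierstrassCurve ℚ) (K : Type) [Field K] [NumberField K],
      kolyvagin N W K)
    (hMN : ∀ (N : ℕ) [NeZero N] (W : WeierstrassCurve ℚ) (K : Type) [Field K] [NumberField K],
      MatarNekovar2019.thm03_padicValNat_card_sha_le_of_irreducible N W K)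
    (hFH : friedbergHoffstein_exists_heegnerField_split_twist_ne_zero)
    (hCM8 : bsdTriple_of_hasCM_of_L_one_ne_zero) (hp5 : 5 ≤ p) :
    ∀ (W : WeierstrassCurve ℚ) [W.IsElliptic] [W.IsGloballyMinimal],
      HasSignedLocalType W p (.Istar 0) → W.analyticRank = 1 →
      ∀ (V : WeierstrassCurve ℚ) [V.IsElliptic] [V.IsGloballyMinimal] (C : VariableChange ℚ)
        {N : ℕ} [NeZero N] {f : CuspForm (Gamma0 N) 2},
        5 ≤ p → C • W.quadraticTwist ((-1) ^ (p / 2) * p) = V →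
        V.HasGoodReductionAtPrime p → V.frobeniusTrace p = 0 → W.analyticRank = 1 →
        IsNewformOf V f →
        ∀ (ϖ : ℚ), (if Even (p / 2) then (ϖ : ℝ) * V.realPeriodRat = plusPeriod f
            else (ϖ : ℝ) * V.imaginaryPeriodRat = minusPeriod f) →
        ∀ (L : IwasawaAlgebra p), Additive.IsQuadraticBranchMinusLFunction f p ϖ L →
        (∀ Q : (W.baseChange ℚ_[p]).toAffine.Point, p • Q = 0 → Q = 0) →
        ∀ (P : W.toAffine.Point) (n : ℕ), ¬ IsOfFinAddOrder P →
        (∀ R : W.toAffine.Point, ∃ (k : ℤ) (T : W.toAffine.Point),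
          IsOfFinAddOrder T ∧ R = k • P + T) →
        (∃ Q : (W.baseChange ℚ_[p]).toAffine.Point, p ^ n • Q = W.toPadicPoint p P) →
        (∀ Q : (W.baseChange ℚ_[p]).toAffine.Point, p ^ (n + 1) • Q ≠ W.toPadicPoint p P) →
        ∀ (q : ℚ), shaAn W = (q : ℂ) →
        ((PowerSeries.coeff 1 L : ℤ_[p]) : ℚ_[p]).valuation ≤
          2 * (n : ℤ) + padicValRat p (q * W.tamagawaProduct / (W.torsionOrder : ℚ) ^ 2) := by
  have h₆' := h₆
  obtain ⟨hmod, -, hGZK, -, hnf, hMaz⟩ := h₆'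
  exact (CccOneStubHalves.stubUpperAt_iff_upperHalfOnType p h₅ h₆ hp5).mpr fun W _ _ hT hr ↦
    missingUpperBoundAt_of_hasSignedLocalType_IstarZero p hGZ hKo hMN hGZK hmod hnf hFH hCM8 hMaz W hp5
      hT hr

end SignedType

/-! ## §2 The K8 leaf re-read: modulo the residuals and published facts ONLY, the leaf
## `X12.CMInertBad` IS the lower half on the type `(p, I₀*)`, `p ≥ 5` -/

section Leaf

/-- **K8 leaf from the lower half, the two residual conjuncts, and PUBLISHED facts only** (the binders
`hup`, `hEdx`, `hDeu`, `hCassels` of `CMRungInputsLowerHalf.cmInertBad_of_lowerHalf_inputs` gone):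
`(∀ p ≥ 5, LowerHalfOnType p I₀*) → InertBadOffType-body → InertBadAtThree-body → (GZ, Kolyvagin,
Matar–Nekovář, GZK, entire L, modularity, Friedberg–Hoffstein, CM rank-0 triple, Mazur Cor. 4.1) →
X12.CMInertBad`. Case split: `p = 3` ↦ `h₃`; `p ≥ 5` on the type ↦ lower half (`hlow`) + upper half
(`missingUpperBoundAt_of_hasSignedLocalType_IstarZero`); off the type ↦ `h₂`. CONDITIONAL; nothing
booked; the leaf, STEP L and O10 stay OPEN. [cite: Mazur1978, Cor. 4.1]
[cite: MatarNekovar2019, Thm. 0.3 and §0.11] [cite: Miller2011LMS, §1 and Def. 1.1] -/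
theorem cmInertBad_of_lowerHalf_facts
    (hlow : ∀ (p : ℕ) [Fact p.Prime], 5 ≤ p → LowerHalfOnType p (.Istar 0))
    (h₂ : ∀ (W : WeierstrassCurve ℚ) [W.IsElliptic] [W.IsGloballyMinimal] (p : ℕ) [Fact p.Prime],
      W.HasCM → W.analyticRank = 1 → CMInert W p → ¬ Good W p → 5 ≤ p →
      ¬ HasSignedLocalType W p (.Istar 0) → X12.MissingInputAt W p)
    (h₃ : ∀ (W : WeierstrassCurve ℚ) [W.IsElliptic] [W.IsGloballyMinimal] [Fact (Nat.Prime 3)],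
      W.HasCM → W.analyticRank = 1 → CMInert W 3 → ¬ Good W 3 → X12.MissingInputAt W 3)
    (hGZ : ∀ (N : ℕ) [NeZero N] (W : WeierstrassCurve ℚ) (K : Type) [Field K] [NumberField K],
      gross_zagier N W K)
    (hKo : ∀ (N : ℕ) [NeZero N] (W : WeierstrassCurve ℚ) (K : Type) [Field K] [NumberField K],
      kolyvagin N W K)
    (hMN : ∀ (N : ℕ) [NeZero N] (W : WeierstrassCurve ℚ) (K : Type) [Field K] [NumberField K],
      MatarNekovar2019.thm03_padicValNat_card_sha_le_of_irreducible N W K)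
    (hGZK : rank_eq_analyticRank_of_analyticRank_le_one) (hmod : hasEntireLFunction_rat)
    (hnf : exists_isNewformOf) (hFH : friedbergHoffstein_exists_heegnerField_split_twist_ne_zero)
    (hCM8 : bsdTriple_of_hasCM_of_L_one_ne_zero) (hMaz : mazur_not_dvd_maninConstant_of_odd) :
    X12.CMInertBad := by
  intro W _ _ p _ hCM hr hp2 hin hbad
  have hpP : p.Prime := Fact.out
  by_cases h3 : p = 3
  · subst h3
    exact h₃ W hCM hr hin hbad
  · have hp5 : 5 ≤ p := hpP.five_le_of_ne_two_of_ne_three hp2 h3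
    by_cases hT : HasSignedLocalType W p (.Istar 0)
    · exact fun _ ↦ missingPPartAt_of_lower_of_upper W p (hlow p hp5 W hT hr)
        (missingUpperBoundAt_of_hasSignedLocalType_IstarZero p hGZ hKo hMN hGZK hmod hnf hFH hCM8 hMaz
          W hp5 hT hr)
    · exact h₂ W p hCM hr hin hbad hp5 hT

/-- **Exact decomposition of the K8 leaf modulo PUBLISHED facts only.** Given the two residual
conjuncts (bodies of `InertBadOffType`, `InertBadAtThree`) and the nine published facts, the rung
leaf `X12.CMInertBad` is EQUIVALENT to the lower half `LowerHalfOnType p I₀*` at every `p ≥ 5` —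
`CMRungInputsLowerHalf.cmInertBad_iff_lowerHalfOnType_of_inputs` with its non-published binder `hup`
(the upper half at `p ∈ {5, 7}`) DISCHARGED and `hEdx hDeu hCassels` dropped. CONDITIONAL; nothing
booked. [cite: Mazur1978, Cor. 4.1] [cite: MatarNekovar2019, Thm. 0.3 and §0.11]
[cite: Miller2011LMS, §1 and Def. 1.1] -/
theorem cmInertBad_iff_lowerHalfOnType_of_facts
    (h₂ : ∀ (W : WeierstrassCurve ℚ) [W.IsElliptic] [W.IsGloballyMinimal] (p : ℕ) [Fact p.Prime],
      W.HasCM → W.analyticRank = 1 → CMInert W p → ¬ Good W p → 5 ≤ p →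
      ¬ HasSignedLocalType W p (.Istar 0) → X12.MissingInputAt W p)
    (h₃ : ∀ (W : WeierstrassCurve ℚ) [W.IsElliptic] [W.IsGloballyMinimal] [Fact (Nat.Prime 3)],
      W.HasCM → W.analyticRank = 1 → CMInert W 3 → ¬ Good W 3 → X12.MissingInputAt W 3)
    (hGZ : ∀ (N : ℕ) [NeZero N] (W : WeierstrassCurve ℚ) (K : Type) [Field K] [NumberField K],
      gross_zagier N W K)
    (hKo : ∀ (N : ℕ) [NeZero N] (W : WeierstrassCurve ℚ) (K : Type) [Field K] [NumberField K],
      kolyvagin N W K)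
    (hMN : ∀ (N : ℕ) [NeZero N] (W : WeierstrassCurve ℚ) (K : Type) [Field K] [NumberField K],
      MatarNekovar2019.thm03_padicValNat_card_sha_le_of_irreducible N W K)
    (hGZK : rank_eq_analyticRank_of_analyticRank_le_one) (hmod : hasEntireLFunction_rat)
    (hnf : exists_isNewformOf) (hFH : friedbergHoffstein_exists_heegnerField_split_twist_ne_zero)
    (hCM8 : bsdTriple_of_hasCM_of_L_one_ne_zero) (hMaz : mazur_not_dvd_maninConstant_of_odd) :
    X12.CMInertBad ↔ ∀ (p : ℕ) [Fact p.Prime], 5 ≤ p → LowerHalfOnType p (.Istar 0) :=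
  ⟨fun hleaf p _ hp5 ↦ Summit.BirchSwinnertonDyer.BirchSwinnertonDyer.Rank1Residual.CMRungInputsLowerHalf.lowerHalfOnType_of_cmInertBad
      hleaf p hp5,
    fun hlow ↦ cmInertBad_of_lowerHalf_facts hlow h₂ h₃ hGZ hKo hMN hGZK hmod hnf hFH hCM8 hMaz⟩

end Leaf

end Summit.BirchSwinnertonDyer.BirchSwinnertonDyer.Theorems.CccOneManinTwist

end
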